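import Mathlib
import HarnessLib
import Summits.Ventures.LatticeQCDFlow.Scoring.CramerWoldDevice

/-!
# The MULTIVARIATE CENTRAL LIMIT THEOREM: for iid square-integrable random vectors in a
# finite-dimensional inner product space, `(√n)⁻¹ Σ_{k<n} (X_k − E X) ⇒ Z`, `Z` the centred
# Gaussian vector with the covariance of `X` — from Mathlib's one-dimensional CLT by Cramér–Wold

HONEST FRAMING: exact (Metropolis-corrected) sampling algorithms for lattice gauge theory;
figures of merit are autocorrelation/cost numbers at stated couplings and volumes; no
continuum-physics claim.

Venture `LatticeQCDFlow` (cell pub-lqcd), topic `Scoring`; FANOUT row 4 (`s0-u1-b`, rung S0-B).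
Mathlib proves the central limit theorem in dimension one
(`ProbabilityTheory.tendstoInDistribution_inv_sqrt_mul_sum_sub`); the printed card is a vector of
jointly fluctuating columns, and the honest statement about it is the JOINT Gaussian limit.
This file derives the multivariate theorem from the one-dimensional one by the Cramér–Wold
device (`Scoring/CramerWoldDevice`): for `t ∈ E`, `⟪t, (√n)⁻¹ Σ (X_k − m)⟫` is the normalised sum
of the iid real variables `⟪t, X_k⟫`, whose variance is `Var ⟪t, X₀⟫`.  The Gaussian limit `Z`
is specified through its one-dimensional marginals (`⟪t, Z⟫ ∼ N(0, Var ⟪t, X₀⟫)` for every `t` —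
which determines its law, by Cramér–Wold uniqueness, though that is not needed), and in
Mathlib's `IsGaussian` vocabulary (**`tendstoInDistribution_inv_sqrt_smul_sum_sub_of_isGaussian`**:
`Z ∼ ν`, `ν` Gaussian with mean zero and `Var[⟪t,·⟫; ν] = Var ⟪t, X₀⟫`), with the isotropic
special case `Z ∼ stdGaussian E` (**`…_stdGaussian`**).  NEW WORK of the cell (the classical
theorem; our formalisation, not in Mathlib); no definition; nothing cited as a fact.

## Content

* `inner_normalisedSum_eq` — the algebra `⟪t, (√n)⁻¹•(Σ X_k − n•m)⟫ = (√n)⁻¹(Σ⟪t,X_k⟫ − n⟪t,m⟫)`;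
* **`tendstoInDistribution_inv_sqrt_smul_sum_sub`** — THE MULTIVARIATE CLT (marginal form);
* `hasLaw_inner_of_isGaussian`, **`tendstoInDistribution_inv_sqrt_smul_sum_sub_of_isGaussian`**;
* **`tendstoInDistribution_inv_sqrt_smul_sum_sub_stdGaussian`** — identity covariance.

NOT CLAIMED: existence of the Gaussian limit for an arbitrary covariance as a constructed
measure (Mathlib's `multivariateGaussian` on `EuclideanSpace` covers it; not restated here);
Lindeberg / triangular arrays; dependent (Markov-chain) summands; Berry–Esseen rates.
-/

noncomputable section

namespace Summit.Ventures.LatticeQCDFlow.Scoring.CardConsistency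

open MeasureTheory ProbabilityTheory Filter Finset
open scoped Topology RealInnerProductSpace

variable {E : Type*} [NormedAddCommGroup E] [InnerProductSpace ℝ E] [FiniteDimensional ℝ E]
  [MeasurableSpace E] [BorelSpace E]
variable {Ω : Type*} [MeasurableSpace Ω] {P : Measure Ω} [IsProbabilityMeasure P]
variable {Ω' : Type*} [MeasurableSpace Ω'] {P' : Measure Ω'} [IsProbabilityMeasure P']

/-! ## §1 The marginal form -/

section Marginal

omit [FiniteDimensional ℝ E] [MeasurableSpace E] [BorelSpace E] in
/-- `⟪t, (√n)⁻¹ • (Σ_{k<n} x_k − n • m)⟫ = (√n)⁻¹ (Σ_{k<n} ⟪t, x_k⟫ − n ⟪t, m⟫)`. [ours] -/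
theorem inner_normalisedSum_eq (t m : E) (x : ℕ → E) (n : ℕ) :
    ⟪t, (Real.sqrt n)⁻¹ • (∑ k ∈ range n, x k - (n : ℝ) • m)⟫
      = (Real.sqrt n)⁻¹ * (∑ k ∈ range n, ⟪t, x k⟫ - n * ⟪t, m⟫) := by
  rw [real_inner_smul_right, inner_sub_right, inner_sum, real_inner_smul_right]

/-- **THE MULTIVARIATE CENTRAL LIMIT THEOREM.**  `X_k : Ω → E` independent, identically
distributed, square integrable random vectors in a finite-dimensional real inner product space;
`Z : Ω' → E` an a.e.-measurable random vector whose every projection `⟪t, Z⟫` is centred Gaussian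
with variance `Var ⟪t, X₀⟫`.  Then
`(√n)⁻¹ • (Σ_{k<n} X_k − n • E X₀) ⇒ Z`. [ours] (Cramér–Wold reduces to Mathlib's
one-dimensional CLT for the iid real sequence `⟪t, X_k⟫`, whose mean is `⟪t, E X₀⟫`) -/
theorem tendstoInDistribution_inv_sqrt_smul_sum_sub {X : ℕ → Ω → E} {Z : Ω' → E}
    (hX2 : MemLp (X 0) 2 P) (hindep : iIndepFun X P)
    (hident : ∀ i, IdentDistrib (X i) (X 0) P P) (hZm : AEMeasurable Z P')
    (hZ : ∀ t : E, HasLaw (fun ω' => ⟪t, Z ω'⟫)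
      (gaussianReal 0 (Var[fun ω => ⟪t, X 0 ω⟫; P]).toNNReal) P') :
    TendstoInDistribution
      (fun (n : ℕ) ω => (Real.sqrt n)⁻¹ • (∑ k ∈ range n, X k ω - (n : ℝ) • P[X 0]))
      atTop Z (fun _ => P) P' := by
  have hXm : ∀ k, AEMeasurable (X k) P := fun k => (hident k).aemeasurable_fst
  have hSm : ∀ n : ℕ, AEMeasurable
      (fun ω => (Real.sqrt n)⁻¹ • (∑ k ∈ range n, X k ω - (n : ℝ) • P[X 0])) P := fun n =>
    aemeasurable_const.smul ((Finset.aemeasurable_fun_sum _ fun k _ => hXm k).sub_const _)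
  refine tendstoInDistribution_of_forall_inner (P := fun _ => P) hSm hZm fun t => ?_
  -- the iid real sequence `⟪t, X_k⟫`
  have hm : Measurable fun x : E => ⟪t, x⟫ := (continuous_const.inner continuous_id).measurable
  have hY2 : MemLp (fun ω => ⟪t, X 0 ω⟫) 2 P := hX2.const_inner t
  have hYindep : iIndepFun (fun k ω => ⟪t, X k ω⟫) P := hindep.comp (fun _ x => ⟪t, x⟫) fun _ => hm
  have hYident : ∀ i, IdentDistrib (fun ω => ⟪t, X i ω⟫) (fun ω => ⟪t, X 0 ω⟫) P P := fun i =>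
    (hident i).comp hm
  have hclt : TendstoInDistribution (fun (n : ℕ) ω => (Real.sqrt n)⁻¹
      * (∑ k ∈ range n, ⟪t, X k ω⟫ - n * P[fun ω => ⟪t, X 0 ω⟫])) atTop (fun ω' => ⟪t, Z ω'⟫)
      (fun _ => P) P' :=
    tendstoInDistribution_inv_sqrt_mul_sum_sub (hZ t) hY2 hYindep hYident
  have hmean : P[fun ω => ⟪t, X 0 ω⟫] = ⟪t, P[X 0]⟫ := integral_inner (hX2.integrable one_le_two) t
  -- the two index-`n` statistics agree pointwise
  refine hclt.congr (fun n => Eventually.of_forall fun ω => ?_) EventuallyEq.rfl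
  beta_reduce at hmean ⊢
  rw [inner_normalisedSum_eq, hmean]

end Marginal

/-! ## §2 In Mathlib's `IsGaussian` vocabulary -/

section Gaussian

omit [FiniteDimensional ℝ E] [IsProbabilityMeasure P'] in
/-- If `Z ∼ ν` with `ν` a Gaussian measure on `E`, then `⟪t, Z⟫ ∼ N(ν[⟪t,·⟫], Var[⟪t,·⟫; ν])`.
[folklore] (Mathlib's `IsGaussian.map_eq_gaussianReal` at the dual vector `⟪t, ·⟫`) -/
theorem hasLaw_inner_of_isGaussian {Z : Ω' → E} {ν : Measure E} [IsGaussian ν]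
    (hZ : HasLaw Z ν P') (t : E) :
    HasLaw (fun ω' => ⟪t, Z ω'⟫)
      (gaussianReal (ν[fun x => ⟪t, x⟫]) (Var[fun x => ⟪t, x⟫; ν]).toNNReal) P' := by
  have hm : Measurable fun x : E => ⟪t, x⟫ := (continuous_const.inner continuous_id).measurable
  refine ⟨(hm.comp_aemeasurable hZ.aemeasurable), ?_⟩
  have h := IsGaussian.map_eq_gaussianReal (μ := ν) (InnerProductSpace.toDualMap ℝ E t)
  have hcoe : ((InnerProductSpace.toDualMap ℝ E t : StrongDual ℝ E) : E → ℝ) = fun x => ⟪t, x⟫ :=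
    rfl
  rw [hcoe] at h
  rw [show (fun ω' => ⟪t, Z ω'⟫) = (fun x : E => ⟪t, x⟫) ∘ Z from rfl,
    ← AEMeasurable.map_map_of_aemeasurable (hm.aemeasurable) hZ.aemeasurable, hZ.map_eq, h]

/-- **THE MULTIVARIATE CLT, Gaussian-measure form.**  `X_k` iid square integrable in `E`;
`Z ∼ ν` with `ν` a Gaussian measure on `E` (`IsGaussian ν`) of mean zero along every projection
and `Var[⟪t,·⟫; ν] = Var ⟪t, X₀⟫` for every `t`.  Then `(√n)⁻¹ • (Σ_{k<n} X_k − n • E X₀) ⇒ Z`.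
[ours] -/
theorem tendstoInDistribution_inv_sqrt_smul_sum_sub_of_isGaussian {X : ℕ → Ω → E}
    {Z : Ω' → E} {ν : Measure E} [IsGaussian ν] (hX2 : MemLp (X 0) 2 P) (hindep : iIndepFun X P)
    (hident : ∀ i, IdentDistrib (X i) (X 0) P P) (hZ : HasLaw Z ν P')
    (hmean : ∀ t : E, ν[fun x => ⟪t, x⟫] = 0)
    (hvar : ∀ t : E, Var[fun x => ⟪t, x⟫; ν] = Var[fun ω => ⟪t, X 0 ω⟫; P]) :
    TendstoInDistribution
      (fun (n : ℕ) ω => (Real.sqrt n)⁻¹ • (∑ k ∈ range n, X k ω - (n : ℝ) • P[X 0]))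
      atTop Z (fun _ => P) P' := by
  refine tendstoInDistribution_inv_sqrt_smul_sum_sub hX2 hindep hident hZ.aemeasurable fun t => ?_
  have h := hasLaw_inner_of_isGaussian hZ t
  rw [hmean t, hvar t] at h
  exact h

/-- **THE MULTIVARIATE CLT, isotropic case.**  `X_k` iid square integrable in `E` with
IDENTITY covariance, `Var ⟪t, X₀⟫ = ‖t‖²` for every `t`; `Z ∼ stdGaussian E`.  Then
`(√n)⁻¹ • (Σ_{k<n} X_k − n • E X₀) ⇒ Z`. [ours] -/
theorem tendstoInDistribution_inv_sqrt_smul_sum_sub_stdGaussian {X : ℕ → Ω → E} {Z : Ω' → E}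
    (hX2 : MemLp (X 0) 2 P) (hindep : iIndepFun X P) (hident : ∀ i, IdentDistrib (X i) (X 0) P P)
    (hZ : HasLaw Z (stdGaussian E) P') (hvar : ∀ t : E, Var[fun ω => ⟪t, X 0 ω⟫; P] = ‖t‖ ^ 2) :
    TendstoInDistribution
      (fun (n : ℕ) ω => (Real.sqrt n)⁻¹ • (∑ k ∈ range n, X k ω - (n : ℝ) • P[X 0]))
      atTop Z (fun _ => P) P' := by
  refine tendstoInDistribution_inv_sqrt_smul_sum_sub_of_isGaussian hX2 hindep hident hZ
    (fun t => ?_) (fun t => ?_)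
  · have h := integral_strongDual_stdGaussian (E := E) (InnerProductSpace.toDualMap ℝ E t)
    exact h
  · have h := variance_dual_stdGaussian (E := E) (InnerProductSpace.toDualMap ℝ E t)
    rw [hvar t]
    refine h.trans ?_
    rw [LinearIsometry.norm_map]

end Gaussian

end Summit.Ventures.LatticeQCDFlow.Scoring.CardConsistency

end
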